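import Literature.InformationTheory.QuantumCodes.QuantumExpanderCriticalGenerators
import HarnessLib

/-!
# Quantum expander codes: a critical generator exists for every small error (Leverrier–Tillich–Zémor
# 2015 Lemma 7 = Fawzi–Grospellier–Leverrier 2018 Lemma 23) — PROOF

Topic `Literature/InformationTheory/QuantumCodes` (venture QEC; the combinatorial core of the small-set-flip
decoder analysis). Sources: LTZ15 = arXiv:1504.00822v1, Lemma 7 (p0008 L95-98) with its proof App. A
(p0012 L1-60, p0013 L1-9); FGL18 = arXiv:1711.08351v2, Lemma 23 (§7.1, p0018 L34-35). Vocabulary of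
`QuantumExpanderCriticalGenerators.lean` (`nbrs`, `uniqueNbrs`, `IsCritical`, `projA`, `projB`, `projBOn`).

* `exists_card_uniqueNbrs_ge` — pigeonhole form of LTZ15 Lemma 3 (`card_uniqueNbhd_ge`,
  `QuantumExpanderCodeParameters.lean`): a non-empty `S ⊆ A` with `|S| ≤ γ n_A` contains `a` with
  `|Γ_u^S(a)| ≥ (1 − 2δ)Δ` ("there exists `a ∈ E_A²` such that `|Γ_u^{E_A²}(a)| ≥ (1 − 2δ_A)Δ_A`", p0012 L26-27).
* `exists_isCritical` — **LTZ15 Lemma 7 / FGL18 Lemma 23, PROVED**: for a `(Δ_A, Δ_B)`-biregular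
  (`Δ_A, Δ_B ≥ 1`) `(γ_A, δ_A, γ_B, δ_B)`-expanding `G` with `δ_A, δ_B ≥ 0` and an error support `E ≠ ∅`
  with `|E| ≤ γ_A n_A`, `|E| ≤ γ_B n_B`, a critical generator exists. Proof as printed (App. A): project
  the `A²`-errors on their second coordinate (`E_A²`), take `a` with many unique neighbours; either no
  `B²`-error sits on a unique-neighbour column of `a` (cases "`E_B = ∅`"/"`E_{B,a} = ∅`": any `b ∼ α` for
  an error `αa`) or project those that do on their first coordinate (`E¹_{B,a}`) and take `b` with many
  unique neighbours; the case `E_A = ∅` is the mirror image. (The printed `δ < 1/2` is not needed for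
  EXISTENCE — it only makes the unique-neighbour bound positive; the bounds `|χ| ≤ 2δΔ` hold as stated.)

No decoder appears in this file.
-/

namespace Literature.InformationTheory.QuantumCodes

namespace QuantumExpander

open Finset Matrix

variable {A B : Type*} [Fintype A] [Fintype B] [DecidableEq A] [DecidableEq B]

/-! ### Pigeonhole form of the unique-neighbour lemma -/

omit [DecidableEq B] in
/-- `Γ_u(S)` (checks with exactly one neighbour in `S`) is the disjoint union of the `Γ_u^S(a)`, `a ∈ S`:
membership. [cite: LeverrierTillichZemor2015, App. A (arXiv v1 p0012 L8-27)] -/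
theorem mem_uniqueNbrs_of_card_eq_one {H : Matrix B A (ZMod 2)} {S : Finset A} {b : B}
    (hb : (S.filter fun a => H b a ≠ 0).card = 1) :
    ∃ a ∈ S, b ∈ uniqueNbrs H S a := by
  obtain ⟨a, ha⟩ := Finset.card_eq_one.1 hb
  have hmem : a ∈ S.filter fun a => H b a ≠ 0 := by rw [ha]; exact Finset.mem_singleton_self _
  rw [Finset.mem_filter] at hmem
  refine ⟨a, hmem.1, mem_uniqueNbrs.2 ⟨hmem.2, fun a' ha' hH => ?_⟩⟩
  have : a' ∈ S.filter fun a => H b a ≠ 0 := Finset.mem_filter.2 ⟨ha', hH⟩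
  rw [ha] at this
  exact Finset.mem_singleton.1 this

/-- **Pigeonhole form of LTZ15 Lemma 3:** if `G` is `(γ, δ)`-left-expanding with left degrees `≤ Δ`, every
non-empty `S ⊆ A` with `|S| ≤ γ n_A` contains a vertex `a` with at least `(1 − 2δ)Δ` unique neighbours
relative to `S` ("there exists `a ∈ E_A²` such that `|Γ_u^{E_A²}(a)| ≥ (1 − 2δ_A)Δ_A`").
[cite: LeverrierTillichZemor2015, App. A (arXiv v1 p0012 L25-27) with Lemma 3 (p0008 L13-27)] -/
theorem exists_card_uniqueNbrs_ge (H : Matrix B A (ZMod 2)) {dA : ℕ} {γ δ : ℝ}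
    (hdeg : ∀ a : A, (univ.filter fun b : B => H b a ≠ 0).card ≤ dA)
    (hexp : IsLeftExpanding H dA γ δ) (S : Finset A) (hS0 : S.Nonempty)
    (hS : (S.card : ℝ) ≤ γ * Fintype.card A) :
    ∃ a ∈ S, (1 - 2 * δ) * dA ≤ ((uniqueNbrs H S a).card : ℝ) := by
  classical
  have h3 := card_uniqueNbhd_ge H hdeg hexp S hS
  -- `|Γ_u(S)| ≤ Σ_{a ∈ S} |Γ_u^S(a)|`
  have hcover : (univ.filter fun b : B => (S.filter fun a => H b a ≠ 0).card = 1)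
      ⊆ S.biUnion (uniqueNbrs H S) := by
    intro b hb
    rw [Finset.mem_filter] at hb
    obtain ⟨a, ha, hba⟩ := mem_uniqueNbrs_of_card_eq_one hb.2
    exact Finset.mem_biUnion.2 ⟨a, ha, hba⟩
  have hle : ((univ.filter fun b : B => (S.filter fun a => H b a ≠ 0).card = 1).card : ℝ)
      ≤ ∑ a ∈ S, ((uniqueNbrs H S a).card : ℝ) := by
    have h1 := Finset.card_le_card hcover
    have h2 := (Finset.card_biUnion_le (s := S) (t := uniqueNbrs H S))
    exact_mod_cast h1.trans h2
  by_contra hall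
  push Not at hall
  have hlt : ∑ a ∈ S, ((uniqueNbrs H S a).card : ℝ) < ∑ a ∈ S, (1 - 2 * δ) * (dA : ℝ) :=
    Finset.sum_lt_sum_of_nonempty hS0 fun a ha => hall a ha
  rw [Finset.sum_const, nsmul_eq_mul] at hlt
  linarith

/-! ### Existence (LTZ15 Lemma 7 / FGL18 Lemma 23) -/

/-- **LTZ15 Lemma 7 / FGL18 Lemma 23 (existence of a critical generator), PROVED.** For a
`(Δ_A, Δ_B)`-biregular (`Δ_A, Δ_B ≥ 1`), `(γ_A, δ_A, γ_B, δ_B)`-left-right-expanding graph with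
`0 ≤ δ_A, δ_B < 1/2` and an error support `E ≠ ∅` with `|E| ≤ γ_A n_A` and `|E| ≤ γ_B n_B`
("`0 < |e| ≤ min(γ_A n_A, γ_B n_B)`"), some generator `g_{ba}` is critical with respect to `E`.
[cite: LeverrierTillichZemor2015, Lemma 7 (arXiv v1 p0008 L95-98) and App. A (p0012-p0013)] [cite: FawziGrospellierLeverrier2018, Lemma 23 (§7.1, arXiv v2 p0018 L34-35)] -/
theorem exists_isCritical (H : Matrix B A (ZMod 2)) {dA dB : ℕ} {γA δA γB δB : ℝ}
    (hreg : IsBiregular H dA dB) (hexp : IsLeftRightExpanding H dA dB γA δA γB δB)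
    (hdA : 0 < dA) (hdB : 0 < dB) (hδA : 0 ≤ δA) (hδB : 0 ≤ δB)
    (E : Finset ((A × A) ⊕ (B × B))) (hE0 : E.Nonempty)
    (hEA : (E.card : ℝ) ≤ γA * Fintype.card A) (hEB : (E.card : ℝ) ≤ γB * Fintype.card B) :
    ∃ (b : B) (a : A) (Χa : Finset A) (Χb : Finset B), IsCritical H dA dB δA δB E b a Χa Χb := by
  classical
  have hdegA : ∀ a : A, (univ.filter fun b : B => H b a ≠ 0).card ≤ dA := fun a => (hreg.1 a).le
  have hdegB : ∀ b : B, (univ.filter fun a : A => Hᵀ a b ≠ 0).card ≤ dB := fun b => by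
    simpa [Matrix.transpose_apply] using (hreg.2 b).le
  have hexpT : IsLeftExpanding Hᵀ dB γB δB := (isLeftExpanding_transpose_iff H dB γB δB).2 hexp.2
  by_cases hSA : (projA E).Nonempty
  · -- Case `E_A ≠ ∅`: a column `a ∈ E_A²` with many unique neighbours
    have hSAcard : ((projA E).card : ℝ) ≤ γA * Fintype.card A :=
      le_trans (by exact_mod_cast card_projA_le E) hEA
    obtain ⟨a, haS, haU⟩ := exists_card_uniqueNbrs_ge H hdegA hexp.1 (projA E) hSA hSAcard
    set Ua := uniqueNbrs H (projA E) a with hUa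
    set Χb := nbrs H a \ Ua with hΧb
    have hΧb_card : (Χb.card : ℝ) ≤ 2 * δA * dA := by
      have h1 : Χb.card = (nbrs H a).card - Ua.card :=
        Finset.card_sdiff_of_subset (uniqueNbrs_subset_nbrs H (projA E) a)
      have h2 : (nbrs H a).card = dA := card_nbrs_eq H hreg a
      have h3 : Ua.card ≤ (nbrs H a).card := Finset.card_le_card (uniqueNbrs_subset_nbrs H _ a)
      have h4 : (Χb.card : ℝ) = dA - Ua.card := by
        rw [h1, Nat.cast_sub h3, h2]
      rw [h4]; linarith
    have hclean_cols : nbrs H a \ Χb = Ua := by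
      rw [hΧb, sdiff_sdiff_right_self, Finset.inf_eq_inter,
        Finset.inter_eq_right.2 (uniqueNbrs_subset_nbrs H (projA E) a)]
    -- the property of the unique columns `β ∈ Γ_u(a)`
    have hcolA : ∀ β ∈ Ua, ∀ (α : A) (a' : A), H β a' ≠ 0 → Sum.inl (α, a') ∈ E → a' = a := by
      intro β hβ α a' hH hE
      rw [hUa, mem_uniqueNbrs] at hβ
      exact hβ.2 a' (mem_projA.2 ⟨α, hE⟩) hH
    set T := projBOn E Ua with hT
    by_cases hT0 : T.Nonempty
    · -- generic case: a row `b ∈ E¹_{B,a}` with many unique neighbours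
      have hTcard : (T.card : ℝ) ≤ γB * Fintype.card B :=
        le_trans (by exact_mod_cast card_projBOn_le E Ua) hEB
      obtain ⟨b, hbT, hbU⟩ := exists_card_uniqueNbrs_ge Hᵀ hdegB hexpT T hT0 hTcard
      set Ub := uniqueNbrs Hᵀ T b with hUb
      set Χa := nbrs Hᵀ b \ Ub with hΧa
      have hΧa_card : (Χa.card : ℝ) ≤ 2 * δB * dB := by
        have h1 : Χa.card = (nbrs Hᵀ b).card - Ub.card :=
          Finset.card_sdiff_of_subset (uniqueNbrs_subset_nbrs Hᵀ T b)
        have h2 : (nbrs Hᵀ b).card = dB := card_nbrs_transpose_eq H hreg b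
        have h3 : Ub.card ≤ (nbrs Hᵀ b).card := Finset.card_le_card (uniqueNbrs_subset_nbrs Hᵀ T b)
        have h4 : (Χa.card : ℝ) = dB - Ub.card := by
          rw [h1, Nat.cast_sub h3, h2]
        rw [h4]; linarith
      have hclean_rows : nbrs Hᵀ b \ Χa = Ub := by
        rw [hΧa, sdiff_sdiff_right_self, Finset.inf_eq_inter,
          Finset.inter_eq_right.2 (uniqueNbrs_subset_nbrs Hᵀ T b)]
      refine ⟨b, a, Χa, Χb, ?_⟩
      refine ⟨Finset.sdiff_subset, Finset.sdiff_subset, hΧa_card, hΧb_card, ?_, ?_⟩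
      · intro α hα β hβ
        rw [hclean_rows] at hα
        rw [hclean_cols] at hβ
        refine ⟨fun a' hH hE => hcolA β hβ α a' hH hE, fun b' hH hE => ?_⟩
        rw [hUb, mem_uniqueNbrs] at hα
        have hb'T : b' ∈ T := by rw [hT, mem_projBOn]; exact ⟨β, hβ, hE⟩
        exact hα.2 b' hb'T (by simpa [Matrix.transpose_apply] using hH)
      · right
        have hb := hbT
        rw [hT, mem_projBOn] at hb
        obtain ⟨β, hβU, hβE⟩ := hb
        exact ⟨β, by rw [hclean_cols]; exact hβU, hβE⟩
    · -- `E_{B,a} = ∅`: any `b ∼ α₀` for an error qubit `α₀ a`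
      rw [Finset.not_nonempty_iff_eq_empty] at hT0
      obtain ⟨α₀, hα₀⟩ := mem_projA.1 haS
      have hcol : 0 < (univ.filter fun b : B => H b α₀ ≠ 0).card := by rw [hreg.1 α₀]; exact hdA
      obtain ⟨b, hb⟩ := Finset.card_pos.1 hcol
      rw [Finset.mem_filter] at hb
      refine ⟨b, a, ∅, Χb, ?_⟩
      refine ⟨Finset.empty_subset _, Finset.sdiff_subset, by simp; positivity, hΧb_card, ?_, ?_⟩
      · intro α hα β hβ
        rw [hclean_cols] at hβ
        refine ⟨fun a' hH hE => hcolA β hβ α a' hH hE, fun b' hH hE => ?_⟩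
        have hb'T : b' ∈ T := by rw [hT, mem_projBOn]; exact ⟨β, hβ, hE⟩
        rw [hT0] at hb'T
        exact absurd hb'T (Finset.notMem_empty _)
      · left
        refine ⟨α₀, ?_, hα₀⟩
        rw [Finset.sdiff_empty, mem_nbrs, Matrix.transpose_apply]
        exact hb.2
  · -- Case `E_A = ∅`: mirror image, a row `b` with many unique neighbours and any `a ∼ β₀`
    rw [Finset.not_nonempty_iff_eq_empty] at hSA
    have hnoA : ∀ (α a' : A), Sum.inl (α, a') ∉ E := by
      intro α a' h
      have : a' ∈ projA E := mem_projA.2 ⟨α, h⟩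
      rw [hSA] at this
      exact Finset.notMem_empty _ this
    have hSB : (projB E).Nonempty := by
      obtain ⟨q, hq⟩ := hE0
      rcases q with ⟨α, a'⟩ | ⟨b, β⟩
      · exact absurd hq (hnoA α a')
      · exact ⟨b, mem_projB.2 ⟨β, hq⟩⟩
    have hSBcard : ((projB E).card : ℝ) ≤ γB * Fintype.card B :=
      le_trans (by exact_mod_cast card_projB_le E) hEB
    obtain ⟨b, hbS, hbU⟩ := exists_card_uniqueNbrs_ge Hᵀ hdegB hexpT (projB E) hSB hSBcard
    set Ub := uniqueNbrs Hᵀ (projB E) b with hUb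
    set Χa := nbrs Hᵀ b \ Ub with hΧa
    have hΧa_card : (Χa.card : ℝ) ≤ 2 * δB * dB := by
      have h1 : Χa.card = (nbrs Hᵀ b).card - Ub.card :=
        Finset.card_sdiff_of_subset (uniqueNbrs_subset_nbrs Hᵀ (projB E) b)
      have h2 : (nbrs Hᵀ b).card = dB := card_nbrs_transpose_eq H hreg b
      have h3 : Ub.card ≤ (nbrs Hᵀ b).card :=
        Finset.card_le_card (uniqueNbrs_subset_nbrs Hᵀ (projB E) b)
      have h4 : (Χa.card : ℝ) = dB - Ub.card := by
        rw [h1, Nat.cast_sub h3, h2]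
      rw [h4]; linarith
    have hclean_rows : nbrs Hᵀ b \ Χa = Ub := by
      rw [hΧa, sdiff_sdiff_right_self, Finset.inf_eq_inter,
        Finset.inter_eq_right.2 (uniqueNbrs_subset_nbrs Hᵀ (projB E) b)]
    obtain ⟨β₀, hβ₀⟩ := mem_projB.1 hbS
    have hrow : 0 < (univ.filter fun a : A => H β₀ a ≠ 0).card := by rw [hreg.2 β₀]; exact hdB
    obtain ⟨a, ha⟩ := Finset.card_pos.1 hrow
    rw [Finset.mem_filter] at ha
    refine ⟨b, a, Χa, ∅, ?_⟩
    refine ⟨Finset.sdiff_subset, Finset.empty_subset _, hΧa_card, by simp; positivity, ?_, ?_⟩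
    · intro α hα β hβ
      rw [hclean_rows] at hα
      refine ⟨fun a' hH hE => absurd hE (hnoA α a'), fun b' hH hE => ?_⟩
      rw [hUb, mem_uniqueNbrs] at hα
      exact hα.2 b' (mem_projB.2 ⟨β, hE⟩) (by simpa [Matrix.transpose_apply] using hH)
    · right
      refine ⟨β₀, ?_, hβ₀⟩
      rw [Finset.sdiff_empty, mem_nbrs]
      exact ha.2


end QuantumExpander

end Literature.InformationTheory.QuantumCodes
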